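import Summits.BirchSwinnertonDyer.BirchSwinnertonDyer.Theorems.EisensteinPrimesTwoVariableKatzBranchRigidity
import Literature.NumberTheory.EllipticCurves.DeShalit1987.KatzMeasureMonomialLinesFrames
import Literature.NumberTheory.EllipticCurves.IntSeriesLinesRigidity
import Literature.NumberTheory.EllipticCurves.Rubin1991.TwoVariableMainConjecture
import HarnessLib

set_option linter.dupNamespace false
set_option autoImplicit false

/-!
# Crux `CycTangentCM.CycTangentBound` (stmt-BirchSwinnertonDyer-22628), stub `stub_selfDual`:
# UNIQUENESS of a two-variable Katz–de Shalit frame at fixed periods from line supplies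

Lead seat `bsd-line-ctcm-p1` g0 (line `tangent-cone-parity`). The self-dual functional equation (SD)
(registered stub `stub_selfDual`, skeleton v3) follows from the cite-only `DeShalit1987.thmII64_…`
once the reflected frame `Ǧ` of `reflect ψ⁻¹ = ψ⁻¹` at `c • S = S` is identified with `G` — i.e. once
two witnesses of the SAME frame `IsKatzMeasure₂ ι v v̄ S κ₁ κ₂ γ₁ γ₂ λ Ω δ Ω_p` are known to be equal.
This file proves that uniqueness GIVEN line supplies:

* `isKatzMeasure₂_ext_of_lineSupplies` — if along infinitely many (`s ∈ ℕ`) `ℤ_p`-quotients `κ_s`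
  through the pair (`pairKer κ₁ κ₂ ≤ ker κ_s`, generators `γ_s`) with pairwise non-proportional
  directions `(κ_s γ₁, κ_s γ₂)`, `κ_s γ₂ ≠ 0`, there is an admissible supply (interpolation data
  `(ρ, r, m, j, hL)` through `κ_s` with `r_k(γ_s) → 1`, `≠ 1` frequently), then `G = G'`:
  each monomial line of `G` and of `G'` is a one-variable branch along `κ_s`
  (`IsKatzMeasure₂.isKatzBranch_monomialLine`, p584493), the two branches coincide
  (`IwasawaTwoVariable.isKatzBranch_ext_of_supply`, bsd-eis), and series with equal restrictions to
  infinitely many non-proportional lines are equal (`IntSeries.eq_of_monomialLine_eq`, p587151).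

The supplies exist in print and, modulo the saturation step (ζ) of the card, in the tree: powers
`Ψ₁^{−n}Ψ₂^{k}`, `k ≤ n`, of the everywhere-unramified characters of types `(w,0)` / `(0,w)`
(p585535, `galConj`), with avatars through the pair (p584708) and entire continuations from Tate
(`heckeLFunction_hasEntireContinuation_of_not_isNormTwist_holds` + norm shifts). THEOREMS ONLY;
nothing about any curve is asserted; supports, does not close, stmt-BirchSwinnertonDyer-22628.

References: [deShalit1987] II.4.12 Remark (iv), II.4.16 (49)–(50), II.4.17 (52)–(54); [Katz1978]
(5.3.0) ("unique measure"); [Cassels1986] Ch. 4 (Strassmann).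
-/

noncomputable section

open scoped Classical Topology
open Filter NumberField IsDedekindDomain Field
  Literature.NumberTheory.EllipticCurves Literature.NumberTheory.GaloisRepresentations
open Summit.BirchSwinnertonDyer.BirchSwinnertonDyer.Theorems.IwasawaTwoVariable

namespace Summit.BirchSwinnertonDyer.BirchSwinnertonDyer.Theorems.CycTangentCMCycTangentBoundFrameUniqueness

variable {p : ℕ} [Fact p.Prime] {K : Type} [Field K] [NumberField K]

/-- **Uniqueness of the two-variable frame at fixed periods, from line supplies.** See the module
docstring. [cite: deShalit1987, II.4.16 (49)–(50) and II.4.17 (52)–(54) (p. 76–78)]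
[cite: Cassels1986, Ch. 4 Thm. 4.1 (Strassmann)] -/
theorem isKatzMeasure₂_ext_of_lineSupplies {ι : PadicAlgCl p ≃+* ℂ}
    {v vbar : HeightOneSpectrum (𝓞 K)} {S : Finset (HeightOneSpectrum (𝓞 K))}
    {κ₁ κ₂ : ZpExtension K p} {γ₁ γ₂ : absoluteGaloisGroup K} {lam : HeckeCharacter K}
    {Ω δ : ℂ} {Ωp : ℂ_[p]} {G G' : PowerSeries (PowerSeries (PadicComplexInt p))}
    (hG : IsKatzMeasure₂ ι v vbar S κ₁ κ₂ γ₁ γ₂ lam Ω δ Ωp G)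
    (hG' : IsKatzMeasure₂ ι v vbar S κ₁ κ₂ γ₁ γ₂ lam Ω δ Ωp G')
    (κ : ℕ → ZpExtension K p) (γ : ℕ → absoluteGaloisGroup K)
    (hκ : ∀ s, ZpExtension.pairKer κ₁ κ₂ ≤ (κ s).kerSubgroup) (hγ : ∀ s, (κ s).IsTopGenerator (γ s))
    (hc₂ : ∀ s, Multiplicative.toAdd (κ s γ₂) ≠ 0)
    (hprop : ∀ s t, s ≠ t → Multiplicative.toAdd (κ s γ₁) * Multiplicative.toAdd (κ t γ₂) ≠
      Multiplicative.toAdd (κ t γ₁) * Multiplicative.toAdd (κ s γ₂))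
    (ρ : ℕ → ℕ → HeckeCharacter K) (r : ℕ → ℕ → FramedGaloisRep K (PadicAlgCl p) 1) (m j : ℕ → ℕ → ℕ)
    (hr : ∀ s k, IsPAdicAvatarOf ι (ρ s k) (r s k)) (hκr : ∀ s k, FactorsThroughZp (κ s) (r s k))
    (hjm : ∀ s k, j s k < m s k)
    (hinf : ∀ s k, (lam * ρ s k).HasInfinityType (fun _ ↦ -(m s k : ℤ)) (fun _ ↦ (j s k : ℤ)))
    (hunr : ∀ s k (w : HeightOneSpectrum (𝓞 K)), w ∉ S → w ≠ vbar → (lam * ρ s k).IsUnramifiedAt w)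
    (hL : ∀ s k, LFunction.HasEntireContinuation (heckeLFunction (lam * ρ s k)))
    (hlim : ∀ s, Tendsto (fun k ↦ avatarValueAt (r s k) (γ s)) atTop (𝓝 1))
    (hne : ∀ s, ∃ᶠ k in atTop, avatarValueAt (r s k) (γ s) ≠ 1) : G = G' := by
  refine IntSeries.eq_of_monomialLine_eq G G' (fun s ↦ Multiplicative.toAdd (κ s γ₁))
    (fun s ↦ Multiplicative.toAdd (κ s γ₂)) hc₂ hprop fun s ↦ ?_
  exact isKatzBranch_ext_of_supply (hG.isKatzBranch_monomialLine (hκ s) (hγ s))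
    (hG'.isKatzBranch_monomialLine (hκ s) (hγ s)) (hr s) (hκr s) (hjm s) (hinf s) (hunr s) (hL s)
    (hlim s) (hne s)

end Summit.BirchSwinnertonDyer.BirchSwinnertonDyer.Theorems.CycTangentCMCycTangentBoundFrameUniqueness

end
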